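import Summits.QuantumFields.YangMills.Theorems.UnitScaleTiltProp7ChartConjPInvT3
import Summits.QuantumFields.YangMills.Theorems.UnitScaleTiltProp7SectET3RealityPInvT3
import Summits.QuantumFields.YangMills.Theorems.UnitScaleTiltProp7SectET3WCurrentProp4RowsT3
import HarnessLib

/-!
# Route `UnitScaleTilt`, crux «MinimiserStabilityRegPr» (stmt-QuantumFields-19200, stub EX `stub_existenceMinimalOrbit`, route (α)) — «HPT-PINV»: **THE CHART'S REALITY ROW `hPT` OF THE LATTICE
# (84) AT THE MEMBER (✓`Prop7Row84AtEtaSlotMember.hasDerivAt_actionZ_chartRay_real_member_eta_su2`, v1.1 of ✓p678874) IS A THEOREM ON THE `𝔰𝔲(2)` SECTOR**: for `‖Y‖ < a_C` with Hermitian–traceless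
# route reading `ιY`, the reading of the lattice chart `T47 H̃ᴾ C̃ εC Y` is again Hermitian–traceless — by (G22)ᴾ ✓`Prop7ChartConjPInv.smul_iota_T47_eq_chart_pinv` (`κ_f • ι(T47 … Y) = χᴾ(κ_f • ιY)`,
# `χᴾ X = X − H46P U₀ (Dfix (CmapTwS U₀) (H46P U₀) C₂ˢ X)`) and (51) ✓`Prop7FibreELOfCritSplit.isHermitian_trace_zero_chartTwS` at `H := H46P U₀` (its reality ✓`H46P_skewHermitian_traceless_at_regPr`).

Cell `ym3-torus` (HUMAN RULING D-0037, YM ladder rung R3 — YM₃ on T³, NOT d = 4, NOT Clay; YM gap NOT proved), width seat `ym3-torus-px21` gen 3 (explicit-unit helper; lineage px21 g0∕g2∕g3).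
THEOREMS ONLY (0 `def`, 0 `sorry`); `--supports stmt-QuantumFields-19200 --as helper`, count-neutral; NO claim on crux ∕ stub ∕ registry.

THE PRINT.  [Balaban1985Variational] (47)–(49) p. 285 (the chart `A = A′ − HD(A′)`), (51) p. 286 («the configurations … are 𝔤-valued»), (80)∕(84) p. 290 (the chart inside `(δ∕δA′)V`); (45) p. 285
`RD*H = 0` is the Landau shadow — the reality shadow is that `H` and `D` map `𝔤`-valued data to `𝔤`-valued fields, so the chart keeps the real subspace.  On the tree's `M₂(ℂ)` carriers this is the
row `hPT` of lit ✓`B11Eq81ExpansionZpow.hasDerivAt_actionZ_chartRay_real` (`P Y → P (T47 H C εC Y)` on the ball) at `P := (ιY Hermitian ∧ traceless)`.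
WHAT IS PROVED (member `F`, `K n`, `h : n ≤ K`, weights `c₀ cB`, `0 ≤ a`; `U₀ ∈ 𝔘_k(ε₀)`; ns `…Theorems.Prop7HPTPInv`):
* §1 `norm_kf_smul_iota_lt` (`‖κ_f • ιY‖ ≤ η‖Y‖ < ε` from `‖Y‖ < a_C`, `η·a_C ≤ ε`; ✓`norm_zeroJet_le`), `skew_of_su2_reading` (`κ_f • ιY` is skew-Hermitian-traceless when `ιY` is Hermitian-traceless),
  `su2_reading_of_kf_smul_eq` (if `κ_f • Z = W` with `(−i)•W` Hermitian-traceless bondwise then `Z`'s reading is Hermitian-traceless).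
* §2 ★★★ `hPT_su2_of_chartConj_pinv` — THE ROW: under (G22)ᴾ's displayed regime∕B13 rows at `C₂ := C₂ˢ := 40M₀ˢ∕(e·η)²` (so that (51)'s contraction window IS (G22)'s `hq`), the (51) window
  `6ε ≤ e·η`, and the two radius nestings `a_C ≤ ε′`, `η·a_C ≤ ε`:
  `∀ Y, ‖Y‖ < a_C → (∀ b, star (ιY b) = ιY b ∧ tr (ιY b) = 0) → ∀ b, star (ι(T47 H̃ᴾ C̃ εC Y) b) = ι(T47 H̃ᴾ C̃ εC Y) b ∧ tr (ι(T47 H̃ᴾ C̃ εC Y) b) = 0` — the `hPT` binder of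
  ✓`hasDerivAt_actionZ_chartRay_real_member_eta_su2` VERBATIM.
HONEST SCOPE.  Bookkeeping over landed rows ((G22)ᴾ, (51), the `H46P` reality); the regime rows stay displayed ((W-X′) numerics, px3∕px14); no estimate; not a proof of any stub; nothing continuum ∕
OS ∕ mass-gap ∕ Clay.
-/

set_option autoImplicit false

noncomputable section

open scoped Matrix.Norms.L2Operator Topology
open Filter Metric NormedSpace

namespace Summit.QuantumFields.YangMills.Theorems.Prop7HPTPInv

open Literature.MathematicalPhysics.QuantumFieldTheory.Balaban1983to89
open Literature.MathematicalPhysics.QuantumFieldTheory.Balaban1983to89.T3ContinuumYM3Torus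
open T3SectALandauChart (eta eta_pos)
open T3PrintedRegularMinimiser (RegPr)
open B9SectCLatticeCarrier (Bond)
open B11Eq115Space (NegSup NegSize Space115 JetSup)
open B11Eq111FrakG (nabla115)
open B13Contraction113 (QuadAnalytic)
open B11Eq174Chart (Regime)
open B11Eq90V0GroupComposed (T47)
open B11Prop3Model (Dfix)
open Summit.QuantumFields.YangMills.Theorems.Prop7SectET3Transport (periodsT3 bondEquiv bgOfCfg)
open Summit.QuantumFields.YangMills.Theorems.Prop7SymAvgTwSym (CmapTwS)
open Summit.QuantumFields.YangMills.Theorems.Prop7SectET3CurvedPropagators (H1f)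
open Summit.QuantumFields.YangMills.Theorems.Prop7SectET3DeltaPiPInv (DeltaPiSlotP H46P)
open Summit.QuantumFields.YangMills.Theorems.Prop7ChartConjPInv (smul_iota_T47_eq_chart_pinv)
open Summit.QuantumFields.YangMills.Theorems.Prop7FibreELOfCritSplit (isHermitian_trace_zero_chartTwS)
open Summit.QuantumFields.YangMills.Theorems.Prop7SectET3RealityPInv (H46P_skewHermitian_traceless_at_regPr)
open Summit.QuantumFields.YangMills.Theorems.Prop7SectET3WCurrentProp4Rows (norm_zeroJet_le)

variable (F : T3Family) (n K : ℕ) (h : n ≤ K) (c₀ cB a : ℝ) [Fact (0 < c₀)] [Fact (0 < cB)] [Fact (0 < (F.L : ℝ))] [Fact (0 < ((F.L : ℝ)⁻¹) ^ (K - n))]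
  (U₀ : GaugeField (F.P K) 0 (Matrix.specialUnitaryGroup (Fin 2) ℂ))

/-! ## §1 Units bookkeeping: `κ_f • ιY` -/

omit [Fact (0 < c₀)] [Fact (0 < cB)] in
/-- `‖κ_f • ιY‖ < ε` from `‖Y‖ < a_C` and `η·a_C ≤ ε` (`‖κ_f‖ = η`, `‖ιY‖ ≤ ‖Y‖` ✓`norm_zeroJet_le`). [cite: Balaban1985Variational, (115) p.294, (5) p.278] -/
theorem norm_kf_smul_iota_lt {aC ε : ℝ} (haCη : eta F n K * aC ≤ ε)
    (Y : Space115 (F.L : ℝ) (((F.L : ℝ)⁻¹) ^ (K - n)) (fun _ : Bond 3 (periodsT3 F K) => K - n)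
        (fun _ : Bond 3 (periodsT3 F K) × Fin 3 => K - n) (nabla115 (((F.L : ℝ)⁻¹) ^ (K - n)) (bgOfCfg F K U₀))) (hY : ‖Y‖ < aC) :
    ‖((((eta F n K : ℝ) : ℂ)) * Complex.I) • (fun b : PBond (F.P K) 0 => JetSup.equiv _ _ _ Y (bondEquiv F K b))‖ < ε := by
  have hη : 0 < eta F n K := eta_pos F n K
  have hι : ‖(fun b : PBond (F.P K) 0 => JetSup.equiv _ _ _ Y (bondEquiv F K b))‖ ≤ ‖Y‖ := norm_zeroJet_le F n K U₀ Y
  have hκ : ‖((((eta F n K : ℝ) : ℂ)) * Complex.I)‖ = eta F n K := by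
    rw [norm_mul, Complex.norm_I, mul_one, Complex.norm_real, Real.norm_of_nonneg hη.le]
  rw [norm_smul, hκ]
  calc eta F n K * ‖(fun b : PBond (F.P K) 0 => JetSup.equiv _ _ _ Y (bondEquiv F K b))‖ ≤ eta F n K * ‖Y‖ := mul_le_mul_of_nonneg_left hι hη.le
    _ < eta F n K * aC := mul_lt_mul_of_pos_left hY hη
    _ ≤ ε := haCη

omit [Fact (0 < c₀)] [Fact (0 < cB)] [Fact (0 < (F.L : ℝ))] [Fact (0 < ((F.L : ℝ)⁻¹) ^ (K - n))] in
/-- `κ_f • ιY` is skew-Hermitian-traceless when `ιY` is Hermitian-traceless (`κ_f = η·i`, `η` real). [cite: Balaban1985Variational, (51) p.286, (5) p.278] -/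
theorem skew_of_su2_reading
    (Y : Space115 (F.L : ℝ) (((F.L : ℝ)⁻¹) ^ (K - n)) (fun _ : Bond 3 (periodsT3 F K) => K - n)
        (fun _ : Bond 3 (periodsT3 F K) × Fin 3 => K - n) (nabla115 (((F.L : ℝ)⁻¹) ^ (K - n)) (bgOfCfg F K U₀)))
    (hYR : ∀ b : PBond (F.P K) 0, star (JetSup.equiv _ _ _ Y (bondEquiv F K b)) = JetSup.equiv _ _ _ Y (bondEquiv F K b) ∧ Matrix.trace (JetSup.equiv _ _ _ Y (bondEquiv F K b)) = 0) :
    ∀ b' : PBond (F.P K) 0, star ((((((eta F n K : ℝ) : ℂ)) * Complex.I) • fun b : PBond (F.P K) 0 => JetSup.equiv _ _ _ Y (bondEquiv F K b)) b')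
        = -(((((eta F n K : ℝ) : ℂ)) * Complex.I) • fun b : PBond (F.P K) 0 => JetSup.equiv _ _ _ Y (bondEquiv F K b)) b' ∧
      Matrix.trace ((((((eta F n K : ℝ) : ℂ)) * Complex.I) • fun b : PBond (F.P K) 0 => JetSup.equiv _ _ _ Y (bondEquiv F K b)) b') = 0 := by
  intro b'
  have hstarc : star ((((eta F n K : ℝ) : ℂ)) * Complex.I) = -((((eta F n K : ℝ) : ℂ)) * Complex.I) := by simp
  simp only [Pi.smul_apply]
  refine ⟨?_, ?_⟩
  · rw [star_smul, (hYR b').1, hstarc, neg_smul]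
  · rw [Matrix.trace_smul, (hYR b').2, smul_zero]

omit [Fact (0 < c₀)] [Fact (0 < cB)] [Fact (0 < (F.L : ℝ))] [Fact (0 < ((F.L : ℝ)⁻¹) ^ (K - n))] in
/-- If `κ_f • Z = W` (as route fields) and every `(−i)•W(b)` is Hermitian and traceless, then every `Z(b)` is Hermitian and traceless (`Z(b) = η⁻¹ • ((−i)•W(b))`).
[cite: Balaban1985Variational, (51) p.286, (5) p.278] -/
theorem su2_reading_of_kf_smul_eq {Z W : PBond (F.P K) 0 → Matrix (Fin 2) (Fin 2) ℂ} (hZW : ((((eta F n K : ℝ) : ℂ)) * Complex.I) • Z = W)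
    (hW : ∀ b', (((-Complex.I) • W) b').IsHermitian ∧ Matrix.trace (((-Complex.I) • W) b') = 0) :
    ∀ b', star (Z b') = Z b' ∧ Matrix.trace (Z b') = 0 := by
  intro b'
  have hη : 0 < eta F n K := eta_pos F n K
  have hηne : (((eta F n K : ℝ) : ℂ)) ≠ 0 := Complex.ofReal_ne_zero.2 hη.ne'
  have hZ : Z b' = ((((eta F n K : ℝ) : ℂ)))⁻¹ • (((-Complex.I) • W) b') := by
    have h1 := congrFun hZW b'
    rw [Pi.smul_apply] at h1
    have hsc : ((((eta F n K : ℝ) : ℂ)))⁻¹ * -Complex.I * (((((eta F n K : ℝ) : ℂ))) * Complex.I) = 1 := by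
      rw [show ((((eta F n K : ℝ) : ℂ)))⁻¹ * -Complex.I * (((((eta F n K : ℝ) : ℂ))) * Complex.I)
          = -(((((eta F n K : ℝ) : ℂ)))⁻¹ * ((((eta F n K : ℝ) : ℂ)))) * (Complex.I * Complex.I) by ring, inv_mul_cancel₀ hηne, Complex.I_mul_I]
      norm_num
    rw [Pi.smul_apply, ← h1, smul_smul, smul_smul, hsc, one_smul]
  obtain ⟨hH, htr⟩ := hW b'
  refine ⟨?_, ?_⟩
  · rw [hZ, star_smul, star_inv₀, Complex.star_def, Complex.conj_ofReal, Matrix.star_eq_conjTranspose, hH.eq]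
  · rw [hZ, Matrix.trace_smul, htr, smul_zero]

/-! ## §2 ★★★ The row `hPT` on the `𝔰𝔲(2)` sector -/

/-- ★★★ **THE CHART `T47 H̃ᴾ C̃ εC` KEEPS HERMITIAN–TRACELESS READINGS ON THE BALL `‖Y‖ < a_C`** — the `hPT` binder of ✓`hasDerivAt_actionZ_chartRay_real_member_eta_su2` VERBATIM, from (G22)ᴾ
✓`smul_iota_T47_eq_chart_pinv` (under its displayed Sect. C ∕ B13 rows, read at the chart-of-record constant `C₂ := C₂ˢ = 40M₀ˢ∕(e·η)²`) + (51) ✓`isHermitian_trace_zero_chartTwS` at `H := H46P U₀`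
(`H46P` real: ✓`H46P_skewHermitian_traceless_at_regPr`, `0 ≤ a`) + the (51) window `6ε ≤ e·η` + the radius nestings `a_C ≤ ε′`, `η·a_C ≤ ε`.
[cite: Balaban1985Variational, (47)–(49) p.285, (51) p.286, (55) p.286, (80) p.290, (84) p.290, Prop. 6 p.295] -/
theorem hPT_su2_of_chartConj_pinv (ha : 0 ≤ a) {ε₀ e : ℝ} (hε₀ : 0 < ε₀) (he : 0 < e) (hWe : 10 ^ 9 * (F.L : ℝ) ^ 2 * e ≤ 1) (hWε : 10 ^ 12 * (F.L : ℝ) ^ 3 * ε₀ ≤ 1)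
    (hreg : RegPr F n K ε₀ U₀) {b C₂ᵣ c₄ aC εC R b₂ ε C₂' R' ε' : ℝ}
    (RC : Regime (H1f F n K h c₀ cB a (DeltaPiSlotP F n K h c₀ cB a) U₀) 0
      (fun A' : Space115 (F.L : ℝ) (((F.L : ℝ)⁻¹) ^ (K - n)) (fun _ : Bond 3 (periodsT3 F K) => K - n)
        (fun _ : Bond 3 (periodsT3 F K) × Fin 3 => K - n) (nabla115 (((F.L : ℝ)⁻¹) ^ (K - n)) (bgOfCfg F K U₀)) =>
          (-Complex.I) • CmapTwS F n K h U₀ (((((eta F n K : ℝ) : ℂ)) * Complex.I) • fun b : PBond (F.P K) 0 => JetSup.equiv _ _ _ A' (bondEquiv F K b)))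
      b 0 C₂ᵣ c₄ 0 aC εC)
    (hC : QuadAnalytic (CmapTwS F n K h U₀) (40 * (2 * (3 * (2 * e + 2700 * (F.L : ℝ) * ε₀))) / (e * eta F n K) ^ 2) R) (hb₂ : 0 ≤ b₂)
    (hHop : ∀ X, ‖H46P F n K h c₀ cB a U₀ X‖ ≤ b₂ * ‖X‖)
    (hq : 9 * (40 * (2 * (3 * (2 * e + 2700 * (F.L : ℝ) * ε₀))) / (e * eta F n K) ^ 2) * b₂ * ε < 1) (hRC : 3 * ε ≤ R) (hRε : 6 * ε ≤ e * eta F n K)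
    (hC' : QuadAnalytic (fun A' : Space115 (F.L : ℝ) (((F.L : ℝ)⁻¹) ^ (K - n)) (fun _ : Bond 3 (periodsT3 F K) => K - n)
        (fun _ : Bond 3 (periodsT3 F K) × Fin 3 => K - n) (nabla115 (((F.L : ℝ)⁻¹) ^ (K - n)) (bgOfCfg F K U₀)) =>
          (-Complex.I) • CmapTwS F n K h U₀ (((((eta F n K : ℝ) : ℂ)) * Complex.I) • fun b : PBond (F.P K) 0 => JetSup.equiv _ _ _ A' (bondEquiv F K b))) C₂' R')
    (hC₂' : 0 ≤ C₂') (hq' : 9 * C₂' * b * ε' < 1) (hRC' : 3 * ε' ≤ R') (hwin : 4 * C₂' * b * ε' ^ 2 ≤ εC)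
    (hnest : 4 * C₂' * ε' ^ 2 ≤ 4 * (40 * (2 * (3 * (2 * e + 2700 * (F.L : ℝ) * ε₀))) / (e * eta F n K) ^ 2) * ε ^ 2)
    (haC : aC ≤ ε') (haCη : eta F n K * aC ≤ ε) :
    ∀ Y : Space115 (F.L : ℝ) (((F.L : ℝ)⁻¹) ^ (K - n)) (fun _ : Bond 3 (periodsT3 F K) => K - n) (fun _ : Bond 3 (periodsT3 F K) × Fin 3 => K - n)
        (nabla115 (((F.L : ℝ)⁻¹) ^ (K - n)) (bgOfCfg F K U₀)), ‖Y‖ < aC →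
      (∀ b : PBond (F.P K) 0, star (JetSup.equiv _ _ _ Y (bondEquiv F K b)) = JetSup.equiv _ _ _ Y (bondEquiv F K b) ∧ Matrix.trace (JetSup.equiv _ _ _ Y (bondEquiv F K b)) = 0) →
      ∀ b : PBond (F.P K) 0,
        star (JetSup.equiv _ _ _ (T47 (H1f F n K h c₀ cB a (DeltaPiSlotP F n K h c₀ cB a) U₀)
            (fun A' : Space115 (F.L : ℝ) (((F.L : ℝ)⁻¹) ^ (K - n)) (fun _ : Bond 3 (periodsT3 F K) => K - n) (fun _ : Bond 3 (periodsT3 F K) × Fin 3 => K - n)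
                (nabla115 (((F.L : ℝ)⁻¹) ^ (K - n)) (bgOfCfg F K U₀)) =>
              (-Complex.I) • CmapTwS F n K h U₀ (((((eta F n K : ℝ) : ℂ)) * Complex.I) • fun b : PBond (F.P K) 0 => JetSup.equiv _ _ _ A' (bondEquiv F K b))) εC Y)
            (bondEquiv F K b))
          = JetSup.equiv _ _ _ (T47 (H1f F n K h c₀ cB a (DeltaPiSlotP F n K h c₀ cB a) U₀)
            (fun A' : Space115 (F.L : ℝ) (((F.L : ℝ)⁻¹) ^ (K - n)) (fun _ : Bond 3 (periodsT3 F K) => K - n) (fun _ : Bond 3 (periodsT3 F K) × Fin 3 => K - n)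
                (nabla115 (((F.L : ℝ)⁻¹) ^ (K - n)) (bgOfCfg F K U₀)) =>
              (-Complex.I) • CmapTwS F n K h U₀ (((((eta F n K : ℝ) : ℂ)) * Complex.I) • fun b : PBond (F.P K) 0 => JetSup.equiv _ _ _ A' (bondEquiv F K b))) εC Y)
            (bondEquiv F K b) ∧
        Matrix.trace (JetSup.equiv _ _ _ (T47 (H1f F n K h c₀ cB a (DeltaPiSlotP F n K h c₀ cB a) U₀)
            (fun A' : Space115 (F.L : ℝ) (((F.L : ℝ)⁻¹) ^ (K - n)) (fun _ : Bond 3 (periodsT3 F K) => K - n) (fun _ : Bond 3 (periodsT3 F K) × Fin 3 => K - n)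
                (nabla115 (((F.L : ℝ)⁻¹) ^ (K - n)) (bgOfCfg F K U₀)) =>
              (-Complex.I) • CmapTwS F n K h U₀ (((((eta F n K : ℝ) : ℂ)) * Complex.I) • fun b : PBond (F.P K) 0 => JetSup.equiv _ _ _ A' (bondEquiv F K b))) εC Y)
            (bondEquiv F K b)) = 0 := by
  intro Y hY hYR
  have hC₂ : 0 ≤ 40 * (2 * (3 * (2 * e + 2700 * (F.L : ℝ) * ε₀))) / (e * eta F n K) ^ 2 := by
    have := eta_pos F n K
    positivity
  have hY' : ‖Y‖ < ε' := lt_of_lt_of_le hY haC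
  have hι : ‖((((eta F n K : ℝ) : ℂ)) * Complex.I) • (fun b : PBond (F.P K) 0 => JetSup.equiv _ _ _ Y (bondEquiv F K b))‖ < ε :=
    norm_kf_smul_iota_lt F n K U₀ haCη Y hY
  -- (G22)ᴾ: the lattice chart read in exponent units IS the pinv chart of the display
  have hG := smul_iota_T47_eq_chart_pinv F n K h c₀ cB a U₀ RC hC hC₂ hb₂ hHop hq hRC hC' hC₂' hq' hRC' hwin hnest hY hY' hι
  -- (51) at `H := H46P U₀` on the skew-Hermitian-traceless point `κ_f • ιY`
  have h51 := isHermitian_trace_zero_chartTwS F h hε₀ he hWe hWε U₀ hreg hb₂ hHop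
    (H46P_skewHermitian_traceless_at_regPr F n K h c₀ cB a U₀ ha hε₀ he hWe hWε hreg) hq hRε hι (skew_of_su2_reading F n K U₀ Y hYR)
  exact su2_reading_of_kf_smul_eq F n K hG h51

end Summit.QuantumFields.YangMills.Theorems.Prop7HPTPInv

end
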